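import Summits.QuantumFields.YangMills.Theorems.SwapVirialDeficitZeroModeGroupThreeBall
import HarnessLib

/-!
# Exact zero-mode rung on the GROUP, three letters — II: straightening the hub onto the `I`-axis
# (rung Z4 in Laplace form; LEAD ym-line-sfw-p2 g93's «exact zero-mode asymptotics»; free-hands support of ⟨stmt-QuantumFields-24197⟩)

Conjugation by a unit quaternion `u` is a linear isometry of `ℍ` (✓`ToronLog.conjIso`) that preserves the unit ball, hence the cone measure (§2), and it
preserves the normalised commutators: `commSq (ūxu) (ūyu) = commSq x y` (§1, via ✓`NearlyCommutingCeiling.comm_conj_of_norm_eq_one`).  With `u = q(a)/‖q(a)‖` (✓`ToronLog.coneQ`, ✓`coneQ_conj`: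
`ū a u = axisPoint a = re a + ‖Im a‖·i`), the inner pair integral of part I depends on the hub only through `(re a, ‖Im a‖)`:
★★ `psiCone_eq_axis` — `ψ_β(a) = ψ_β(axisPoint a)` whenever `q(a) ≠ 0`, i.e. off the null half-line `{Im a ∈ ℝ_{≤0}·i}` (§3, ★ `psiCone_eq_axis_ae`:
for cone-a.e. hub), hence ★★ `ofReal_laplaceThree_eq_lintegral_axis` — `Λ₃(β) = ∫ ψ_β(re a + ‖Im a‖·i) dcone(a)`.
HONEST LABEL: finite-dimensional measure theory on `SU(2)³` (plan-level zero-mode rung); NOT the fixed-`L` sharp law, NOT ⟨24197⟩; the Yang–Mills mass gap is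
NOT proved; no summit is proved by a line.  Width seat ym-line-sfw-p2-w2 g55 (cell ym-idea-1, free hands; own crux ⟨22884⟩ blocked-on ⟨19935⟩),
`--supports stmt-QuantumFields-24197`.  THEOREMS ONLY (0 `def`, 0 `sorry`), standard axioms; the three local instances of the ToronLog files.
References: [cite: GonzalezarroyoAltes1988]; [cite: Vanbaal2001]; [folklore].
-/

set_option autoImplicit false

noncomputable section

open MeasureTheory Quaternion Set
open scoped Quaternion ENNReal BigOperators
open Literature.MathematicalPhysics.QuantumLattice
open Literature.MathematicalPhysics.QuantumFieldTheory (haarProbability)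
open Summit.QuantumFields.YangMills.Theorems.SwapTwistDeficit.ToronLog
open Summit.QuantumFields.YangMills.Theorems.ToronValleyVolume.NearlyCommutingCeiling (norm_conj_of_norm_eq_one comm_conj_of_norm_eq_one)

attribute [local instance] Literature.Analysis.FluidPDE.Tao2016.quatMeasurableSpace
  Literature.Analysis.FluidPDE.Tao2016.quatBorelSpace
  Literature.MathematicalPhysics.QuantumLattice.secondCountableTopology_su2

namespace Summit.QuantumFields.YangMills.Theorems.SwapVirialDeficit.ZeroModeGroup

/-! ## §1 Conjugation by a unit quaternion preserves the normalised commutators -/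

/-- ★ **`commSq (ūxu) (ūyu) = commSq x y`** for a unit quaternion `u`. [folklore] -/
theorem commSq_conj {u : ℍ} (hu : ‖u‖ = 1) (x y : ℍ) : commSq (star u * x * u) (star u * y * u) = commSq x y := by
  rw [commSq_def, commSq_def, comm_conj_of_norm_eq_one hu, norm_conj_of_norm_eq_one hu, norm_conj_of_norm_eq_one hu,
    norm_conj_of_norm_eq_one hu]

/-- `blockThree` is invariant under simultaneous conjugation of the three letters. [folklore] -/
theorem blockThree_conj {u : ℍ} (hu : ‖u‖ = 1) (x y a : ℍ) :
    blockThree (star u * x * u) (star u * y * u) (star u * a * u) = blockThree x y a := by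
  rw [blockThree_def, blockThree_def, commSq_conj hu, commSq_conj hu, commSq_conj hu]

/-! ## §2 Conjugation preserves the cone measure -/

/-- Conjugation by a unit quaternion preserves the cone measure (a linear isometry preserving the unit ball). [folklore] -/
theorem measurePreserving_conjIso_cone (u : ℍ) (hu : ‖u‖ = 1) : MeasurePreserving (conjIso u hu) coneMeasure coneMeasure := by
  have hvol : MeasurePreserving (conjIso u hu) volume volume := (conjIso u hu).measurePreserving
  have hpre : (conjIso u hu) ⁻¹' Metric.ball (0 : ℍ) 1 = Metric.ball 0 1 := by
    ext y
    simp only [Set.mem_preimage, Metric.mem_ball, dist_zero_right, LinearIsometryEquiv.norm_map]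
  have hres : MeasurePreserving (conjIso u hu) (volume.restrict (Metric.ball (0 : ℍ) 1)) (volume.restrict (Metric.ball 0 1)) := by
    have h := hvol.restrict_preimage_emb (conjIso u hu).toHomeomorph.measurableEmbedding (Metric.ball (0 : ℍ) 1)
    rwa [hpre] at h
  unfold coneMeasure
  exact hres.smul_measure _

/-- The pair map `(x, y) ↦ (ūxu, ūyu)` preserves `cone ⊗ cone`. [folklore] -/
theorem measurePreserving_conjIso_prod (u : ℍ) (hu : ‖u‖ = 1) :
    MeasurePreserving (Prod.map (conjIso u hu) (conjIso u hu)) (coneMeasure.prod coneMeasure) (coneMeasure.prod coneMeasure) := by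
  haveI := isProbabilityMeasure_coneMeasure
  exact (measurePreserving_conjIso_cone u hu).prod (measurePreserving_conjIso_cone u hu)

/-! ## §3 The inner pair integral depends on the hub only through `(re a, ‖Im a‖)` -/

/-- The straightening unit quaternion: for `q(a) ≠ 0`, `u = q(a)/‖q(a)‖` has `‖u‖ = 1`. [folklore] -/
theorem norm_unitConeQ {a : ℍ} (ha : coneQ a ≠ 0) : ‖(‖coneQ a‖⁻¹ • coneQ a)‖ = 1 := by
  rw [norm_smul, norm_inv, norm_norm, inv_mul_cancel₀ (norm_ne_zero_iff.2 ha)]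

/-- The straightening conjugation sends the hub to its axis point: `ū a u = re a + ‖Im a‖·i`. [folklore] -/
theorem conj_unitConeQ_self {a : ℍ} (ha : coneQ a ≠ 0) :
    star (‖coneQ a‖⁻¹ • coneQ a) * a * (‖coneQ a‖⁻¹ • coneQ a) = axisPoint a := by
  have hn : ‖coneQ a‖ ≠ 0 := norm_ne_zero_iff.2 ha
  have hns : normSq (coneQ a) ≠ 0 := (normSq_ne_zero).2 ha
  rw [Quaternion.star_smul, star_coneQ, smul_mul_assoc, smul_mul_assoc, mul_smul_comm, smul_smul, coneQ_conj, smul_smul,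
    ← mul_inv, ← Quaternion.normSq_eq_norm_mul_self, inv_mul_cancel₀ hns, one_smul]

/-- ★★ **`ψ_β(a) = ψ_β(axisPoint a)`** whenever `q(a) ≠ 0`: rotate both inner letters by the straightening conjugation (§1–§2). [folklore] -/
theorem psiCone_eq_axis (β : ℝ) {a : ℍ} (ha : coneQ a ≠ 0) : psiCone β a = psiCone β (axisPoint a) := by
  haveI := isProbabilityMeasure_coneMeasure
  set u : ℍ := ‖coneQ a‖⁻¹ • coneQ a with hu_def
  have hu : ‖u‖ = 1 := norm_unitConeQ ha
  have hP := measurePreserving_conjIso_prod u hu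
  -- the integrand at the axis point, as a measurable function on `ℍ × ℍ`
  have hF : Measurable fun p : ℍ × ℍ => ENNReal.ofReal (Real.exp (-(β * blockThree p.1 p.2 (axisPoint a)))) :=
    (measurable_expBlock β).comp (measurable_fst.prodMk (measurable_snd.prodMk measurable_const))
  rw [psiCone_def, psiCone_def, ← hP.lintegral_comp hF]
  refine lintegral_congr fun p => ?_
  -- pointwise: `blockThree x y a = blockThree (ūxu) (ūyu) (ūau)` and `ūau = axisPoint a`
  have h := blockThree_conj hu p.1 p.2 a
  rw [conj_unitConeQ_self ha] at h
  simp only [Prod.map_fst, Prod.map_snd, conjIso_apply]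
  rw [h]

/-- `q(a) ≠ 0` unless `Im a` lies on the closed negative `i`-half-line: if `a.imJ ≠ 0` then `q(a) ≠ 0`. [folklore] -/
theorem coneQ_ne_zero_of_imJ_ne_zero {a : ℍ} (ha : a.imJ ≠ 0) : coneQ a ≠ 0 := by
  intro h
  have h3 : (coneQ a).imK = 0 := by rw [h]; rfl
  simp only [coneQ] at h3
  exact ha h3

/-- The hyperplane `{a | a.imJ = 0}` of `ℍ`, as a real submodule. [folklore] -/
theorem exists_submodule_imJ : ∃ K : Submodule ℝ ℍ, (K : Set ℍ) = {a : ℍ | a.imJ = 0} ∧ K ≠ ⊤ := by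
  refine ⟨{ carrier := {a : ℍ | a.imJ = 0}
            add_mem' := fun {x y} hx hy => by simp only [Set.mem_setOf_eq] at hx hy ⊢; rw [Quaternion.imJ_add, hx, hy, add_zero]
            zero_mem' := by simp
            smul_mem' := fun c x hx => by simp only [Set.mem_setOf_eq] at hx ⊢; rw [Quaternion.imJ_smul, hx, smul_zero] }, rfl, ?_⟩
  intro htop
  have h1 : (⟨0, 0, 1, 0⟩ : ℍ) ∈ ({ carrier := {a : ℍ | a.imJ = 0}, add_mem' := _, zero_mem' := _, smul_mem' := _ } : Submodule ℝ ℍ) :=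
    htop ▸ Submodule.mem_top
  have h2 : ((⟨0, 0, 1, 0⟩ : ℍ)).imJ = 0 := h1
  exact one_ne_zero h2

/-- The hyperplane `{a | a.imJ = 0}` is Lebesgue-null. [folklore] -/
theorem volume_imJ_eq_zero : (volume : Measure ℍ) {a : ℍ | a.imJ = 0} = 0 := by
  obtain ⟨K, hK, hKtop⟩ := exists_submodule_imJ
  rw [← hK]
  exact Measure.addHaar_submodule volume K hKtop

/-- ★ For cone-almost every hub, `q(a) ≠ 0`. [folklore] -/
theorem ae_coneQ_ne_zero : ∀ᵐ a ∂coneMeasure, coneQ a ≠ 0 := by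
  have hvol : ∀ᵐ a ∂(volume : Measure ℍ), coneQ a ≠ 0 := by
    have h : ∀ᵐ a ∂(volume : Measure ℍ), a.imJ ≠ 0 := by
      rw [ae_iff]; simpa only [ne_eq, not_not] using volume_imJ_eq_zero
    filter_upwards [h] with a ha using coneQ_ne_zero_of_imJ_ne_zero ha
  unfold coneMeasure
  exact Measure.ae_smul_measure (ae_restrict_of_ae hvol) _

/-- ★★ **`Λ₃(β) = ∫ ψ_β(re a + ‖Im a‖·i) dcone(a)`** (`β ≥ 0`). [folklore] -/
theorem ofReal_laplaceThree_eq_lintegral_axis {β : ℝ} (hβ : 0 ≤ β) :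
    ENNReal.ofReal (laplaceThree β) = ∫⁻ a, psiCone β (axisPoint a) ∂coneMeasure := by
  rw [ofReal_laplaceThree_eq_lintegral_psiCone hβ]
  refine lintegral_congr_ae ?_
  filter_upwards [ae_coneQ_ne_zero] with a ha using psiCone_eq_axis β ha

end Summit.QuantumFields.YangMills.Theorems.SwapVirialDeficit.ZeroModeGroup

end
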